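import Literature.NumberTheory.Automorphic.PopaZagierOrbitSums
import HarnessLib

/-!
# Popa–Zagier: property (A) implies Hecke-equivariance of M-symbols (abstract form)

Theorems and definitions with bodies only (D-0026). This is the weight-`2`, induced-module case
of [PopaZagier2017, Thm. 1] ("an element `T̃_n ∈ ℚ[M_n]` satisfying (A) acts on period
polynomials of `Γ`-invariant vector-valued forms like the Hecke operator `T_n`"), in a form that
isolates all of the analysis into two hypotheses on an abstract *symbol family*.

**Setting.** `X` is a set with a right action `act` of a multiplicatively closed set `good` of
integer `2 × 2` matrices containing `SL₂(ℤ)` and stable under `adj` and `-1` (in the application: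
`X = Γ₀(N) \ SL₂(ℤ) ≅ ℙ¹(ℤ/Nℤ)`, `good = {det prime to N}`, the action by right multiplication
of bottom rows). A *symbol family* is a potential `ψ : X → ℤ² → A` (in the application
`ψ_y(v) = {∞, k_y v}_f`, the modular symbol of a cusp form `f` from `∞` to the cusp `k_y v`,
`Γ₀(N) k_y = y`), homogeneous in `v` and `SL₂(ℤ)`-equivariant up to constants:
`ψ_{y γ}(v) - ψ_{y γ}(w) = ψ_y(γ v) - ψ_y(γ w)`. Its M-symbol is
`[y] = ψ_y(e₀) - ψ_y(e₁) = {k_y 0, k_y ∞}_f`.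

**Theorem** (`finsum_smul_msym_eq`). Let `n > 0` and let `ξ : M₂(ℤ) → ℚ` be finitely
supported on matrices of determinant `n` (all `good`), and satisfy property (A) in the orbit-sum
form of `PopaZagierOrbitSums` (`∑_k ζ₀(T^k M) = 𝟙[M₁₀ = 0] - 𝟙[M₁₁ = 0]`, `ζ₀ = (1 - S)ξ`; for the
explicit element this is `PopaZagierHeckeElementPropertyA.orbT_zeta0_coeffN_eq`). Then for every
symbol family and every `y`,
`∑_M ξ(M) [y · adj M] = 2 ∑_{C ∈ R_n} (ψ_{y S⁻¹ adj C}(C e₁) - ψ_{y S⁻¹ adj C}(e₀))`,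
`R_n = {(a b; 0 d) : ad = n, 0 ≤ b < d}` (`hermiteReps n`). In the application the right-hand side
is `2 {k_y 0, k_y ∞}_{T_n f}` (Hermite normal form of `M k_y S⁻¹`, `M ∈ R_n`), so the left-hand
side — the M-symbol of `f` against the explicit operator `∑_M ξ(M) e_{y adj M}` on `ℚ[X]` — is
the M-symbol of `T_n f`: the Hecke operator on `S₂(Γ₀(N))` is computed on Manin symbols by `ξ`
(cf. [PopaZagier2017, §1, Thm. 1 and §5]; L. Merel's universal Hecke formula).

**Proof** (loc. cit. §2, proof of Thm. 1, with the Eichler integral replaced by the "Eichler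
function" `E(B)_y = ψ_y(e₀) - ψ_y(B e₀) = {k_y B ∞, k_y ∞}`): matrices act on functions
`G : M₂(ℤ) → (X → A)` by `(G‖B)(C)_y = G(BC)_{y adj B}`; then `E‖T = E`, `E - E‖S = [·]`
(constant in `C`), so `∑_M ζ₀(M) (E‖M) = ∑_M ξ(M) [· adj M]`; by (A) and the *pairing lemma*
(`finsum_smul_eq_zero_of_orbT`: a finitely supported `η` with vanishing `Γ_∞`-orbit sums pairs to
zero against any `T`-invariant `W`, i.e. `η ∈ (1 - T)ℚ[M_n]`) one may replace `ζ₀` by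
`𝟙_{±R_n} - 𝟙_{±R_n S⁻¹}`, whose pairing with `E` is the right-hand side.

## References

* [PopaZagier2017] A. A. Popa, D. Zagier, J. reine angew. Math. 762 (2020), §1 (A), §2 Thm. 1, §5.
-/

namespace Literature.NumberTheory.Automorphic.PopaZagier

open Matrix

/-- `e₀ = (1, 0)ᵀ`, the cusp `∞`. [folklore] -/
def e0 : Fin 2 → ℤ := ![1, 0]

/-- `e₁ = (0, 1)ᵀ = S e₀`, the cusp `0`. [folklore] -/
def e1 : Fin 2 → ℤ := ![0, 1]

/-- `B v` for a `2 × 2` matrix, entrywise. [folklore] -/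
theorem mulVec_two (B : Mat) (v : Fin 2 → ℤ) (i : Fin 2) : (B *ᵥ v) i = B i 0 * v 0 + B i 1 * v 1 := by
  simp [Matrix.mulVec, dotProduct, Fin.sum_univ_two]

/-- `S e₀ = e₁`. [folklore] -/
theorem matS_mulVec_e0 : matS *ᵥ e0 = e1 := by
  ext i; fin_cases i <;> simp [mulVec_two, e0, e1]

/-- `adj S = -S`. [folklore] -/
theorem adjugate_matS : adjugate matS = -matS := by
  rw [Matrix.adjugate_fin_two]
  ext i j; fin_cases i <;> fin_cases j <;> simp [matS]

/-- `adj T = T⁻¹`. [folklore] -/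
theorem adjugate_matT (k : ℤ) : adjugate (matT k) = matT (-k) := by
  rw [Matrix.adjugate_fin_two]
  ext i j; fin_cases i <;> fin_cases j <;> simp [matT]


section Abstract

variable {X : Type*} {A : Type*} [AddCommGroup A]

/-- A right action `act` of a set `good` of integer matrices on `X`: `good` is closed under
products, `-1`, adjugates and contains `SL₂(ℤ)`; `act` is a right action of `good` on which `-1`
acts trivially (in the application: `ℙ¹(ℤ/Nℤ)` with bottom-row multiplication by matrices of
determinant prime to `N`). [cite: PopaZagier2017, §5] -/
structure CosetAction (good : Mat → Prop) (act : X → Mat → X) : Prop where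
  /-- `good` is multiplicatively closed. -/
  mul : ∀ {B B' : Mat}, good B → good B' → good (B * B')
  /-- `good` is stable under `-1`. -/
  neg : ∀ {B : Mat}, good B → good (-B)
  /-- `good` is stable under adjugate. -/
  adj : ∀ {B : Mat}, good B → good (adjugate B)
  /-- `good ⊇ SL₂(ℤ)`. -/
  of_det : ∀ {B : Mat}, B.det = 1 → good B
  /-- `1` acts trivially. -/
  act_one : ∀ x, act x 1 = x
  /-- right action. -/
  act_mul : ∀ x {B B' : Mat}, good B → good B' → act (act x B) B' = act x (B * B')
  /-- `-1` acts trivially. -/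
  act_neg : ∀ x {B : Mat}, good B → act x (-B) = act x B

/-- A **symbol family** (potential form): `ψ_y(v)` homogeneous in `v ∈ ℤ²` and `SL₂(ℤ)`-equivariant
up to constants in the differences, `ψ_{y γ}(v) - ψ_{y γ}(w) = ψ_y(γ v) - ψ_y(γ w)` (in the
application `ψ_y(v) = {∞, k_y v}_f`, and the identity is `{k_{yγ} v, k_{yγ} w} = {k_y γ v, k_y γ w}`,
`k_{yγ} ∈ Γ₀(N) k_y γ`). [cite: PopaZagier2017, §2, §5] -/
structure SymbolFamily (act : X → Mat → X) (ψ : X → (Fin 2 → ℤ) → A) : Prop where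
  /-- homogeneity -/
  smul : ∀ y (c : ℤ) (v : Fin 2 → ℤ), c ≠ 0 → ψ y (c • v) = ψ y v
  /-- equivariance of differences under `SL₂(ℤ)` on nonzero vectors (`{k γ v, k γ w}` only makes
  sense for cusps, i.e. nonzero `v`, `w`) -/
  equivar : ∀ y (γ : Mat), γ.det = 1 → ∀ v w : Fin 2 → ℤ, v ≠ 0 → w ≠ 0 →
    ψ (act y γ) v - ψ (act y γ) w = ψ y (γ *ᵥ v) - ψ y (γ *ᵥ w)

variable (act : X → Mat → X) (ψ : X → (Fin 2 → ℤ) → A)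

/-- The **M-symbol** `[y] = ψ_y(e₀) - ψ_y(e₁)` (`= {k_y 0, k_y ∞}_f`). [cite: PopaZagier2017, §5] -/
def msym (y : X) : A := ψ y e0 - ψ y e1

/-- The **Eichler function** `E(B)_y = ψ_y(e₀) - ψ_y(B e₀)` (`= {k_y B∞, k_y ∞}_f`, the Eichler
integral of `f|k_y` "evaluated at the cusp `B∞`"). [cite: PopaZagier2017, §2] -/
def eich (B : Mat) (y : X) : A := ψ y e0 - ψ y (B *ᵥ e0)

/-- The pairing of the slash action with the Eichler function:
`W_C,y(M) = (E‖M)(C)_y = E(MC)_{y adj M}`. [cite: PopaZagier2017, §2] -/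
def eichW (C : Mat) (y : X) (M : Mat) : A := eich ψ (M * C) (act y (adjugate M))

variable {act ψ} {good : Mat → Prop}

omit [AddCommGroup A] in
/-- `e₀ ≠ 0`. [folklore] -/
theorem e0_ne_zero : e0 ≠ 0 := fun h => by simpa [e0] using congrFun h 0

omit [AddCommGroup A] in
/-- A matrix with nonzero determinant kills no nonzero vector. [folklore] -/
theorem mulVec_ne_zero_of_det_ne_zero {B : Mat} (hB : B.det ≠ 0) {v : Fin 2 → ℤ} (hv : v ≠ 0) :
    B *ᵥ v ≠ 0 := by
  intro h
  apply hv
  have h2 : adjugate B *ᵥ (B *ᵥ v) = 0 := by rw [h, Matrix.mulVec_zero]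
  rw [Matrix.mulVec_mulVec, adjugate_mul, Matrix.smul_mulVec, Matrix.one_mulVec] at h2
  funext i
  have := congrFun h2 i
  simp only [Pi.smul_apply, smul_eq_mul, Pi.zero_apply, mul_eq_zero] at this
  exact this.resolve_left hB

/-- `E‖γ = E + const` for `γ ∈ SL₂(ℤ)`: `(E‖γ)(C)_y = E(C)_y + (ψ_y(adj γ e₀) - ψ_y(e₀))`
(for `C` with nonzero first column). [cite: PopaZagier2017, §2] -/
theorem eichW_of_det_one (hψ : SymbolFamily act ψ) {γ : Mat} (hγ : γ.det = 1) (C : Mat)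
    (hC0 : C *ᵥ e0 ≠ 0) (y : X) :
    eichW act ψ C y γ = eich ψ C y + (ψ y (adjugate γ *ᵥ e0) - ψ y e0) := by
  unfold eichW eich
  have hadj : (adjugate γ).det = 1 := by rw [det_adjugate, hγ]; simp
  have hγC : (γ * C) *ᵥ e0 ≠ 0 := by
    rw [← Matrix.mulVec_mulVec]
    exact mulVec_ne_zero_of_det_ne_zero (by rw [hγ]; exact one_ne_zero) hC0
  have h := hψ.equivar y (adjugate γ) hadj e0 ((γ * C) *ᵥ e0) e0_ne_zero hγC
  rw [h]
  have : adjugate γ *ᵥ ((γ * C) *ᵥ e0) = C *ᵥ e0 := by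
    rw [Matrix.mulVec_mulVec, ← Matrix.mul_assoc, adjugate_mul, hγ, one_smul, Matrix.one_mul]
  rw [this]
  abel

/-- **`E‖T = E`.** [cite: PopaZagier2017, §2 (`f̃|T = f̃`)] -/
theorem eichW_matT (hψ : SymbolFamily act ψ) (C : Mat) (hC0 : C *ᵥ e0 ≠ 0) (y : X) :
    eichW act ψ C y (matT 1) = eich ψ C y := by
  rw [eichW_of_det_one hψ (det_matT 1) C hC0, adjugate_matT]
  have : matT (-1) *ᵥ e0 = e0 := by ext i; fin_cases i <;> simp [mulVec_two, e0]
  rw [this, sub_self, add_zero]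

/-- **`E - E‖S = [·]`** (constant in `C`). [cite: PopaZagier2017, §2 (`f̃|(1 - S) = r_f`)] -/
theorem eich_sub_eichW_matS (hψ : SymbolFamily act ψ) (C : Mat) (hC0 : C *ᵥ e0 ≠ 0) (y : X) :
    eich ψ C y - eichW act ψ C y matS = msym ψ y := by
  rw [eichW_of_det_one hψ det_matS C hC0, adjugate_matS]
  have h1 : (-matS) *ᵥ e0 = (-1 : ℤ) • e1 := by
    rw [Matrix.neg_mulVec, matS_mulVec_e0]; simp
  rw [h1, hψ.smul y (-1) e1 (by norm_num)]
  unfold msym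
  abel

/-- `E(-B) = E(B)`. [folklore] -/
theorem eich_neg (hψ : SymbolFamily act ψ) (B : Mat) (y : X) : eich ψ (-B) y = eich ψ B y := by
  unfold eich
  rw [Matrix.neg_mulVec, show -(B *ᵥ e0) = (-1 : ℤ) • (B *ᵥ e0) by simp,
    hψ.smul y (-1) _ (by norm_num)]

/-- `W(-M) = W(M)`. [folklore] -/
theorem eichW_neg (hC : CosetAction good act) (hψ : SymbolFamily act ψ) (C : Mat) (y : X) {M : Mat}
    (hM : good M) : eichW act ψ C y (-M) = eichW act ψ C y M := by
  unfold eichW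
  rw [Matrix.neg_mul, eich_neg hψ, show adjugate (-M) = -adjugate M from by
    rw [Matrix.adjugate_fin_two, Matrix.adjugate_fin_two]
    ext i j; fin_cases i <;> fin_cases j <;> simp, hC.act_neg y (hC.adj hM)]

/-- **`W` is `T`-invariant**: `(E‖TM)(C)_y = (E‖M)(C)_y`, from `E‖T = E`. [cite: PopaZagier2017, §2] -/
theorem eichW_matT_mul (hC : CosetAction good act) (hψ : SymbolFamily act ψ) (C : Mat) (y : X)
    {M : Mat} (hM : good M) (hMC : (M * C) *ᵥ e0 ≠ 0) :
    eichW act ψ C y (matT 1 * M) = eichW act ψ C y M := by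
  have hT : good (matT 1) := hC.of_det (det_matT 1)
  unfold eichW
  rw [Matrix.adjugate_mul_distrib, ← hC.act_mul y (hC.adj hM) (hC.adj hT), Matrix.mul_assoc]
  exact eichW_matT hψ (M * C) hMC (act y (adjugate M))

/-- `T`-invariance along a whole orbit. [folklore] -/
theorem eichW_matT_zpow_mul (hC : CosetAction good act) (hψ : SymbolFamily act ψ) (C : Mat) (y : X)
    (hgoodT : ∀ (k : ℤ) (M : Mat), good M → good (matT k * M)) {M : Mat} (hM : good M)
    (hMC : (M * C) *ᵥ e0 ≠ 0) (k : ℤ) :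
    eichW act ψ C y (matT k * M) = eichW act ψ C y M := by
  have hTMC : ∀ j : ℤ, (matT j * M * C) *ᵥ e0 ≠ 0 := fun j => by
    rw [Matrix.mul_assoc, ← Matrix.mulVec_mulVec]
    exact mulVec_ne_zero_of_det_ne_zero (by rw [det_matT]; exact one_ne_zero) hMC
  induction k using Int.induction_on with
  | zero => rw [matT_zero, Matrix.one_mul]
  | succ k ih =>
    rw [show matT ((k : ℤ) + 1) = matT 1 * matT k by rw [matT_mul_matT, add_comm], Matrix.mul_assoc,
      eichW_matT_mul hC hψ C y (hgoodT k M hM) (hTMC k), ih]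
  | pred k ih =>
    rw [← ih, show matT (-(k : ℤ)) = matT 1 * matT (-(k : ℤ) - 1) by rw [matT_mul_matT]; ring_nf,
      Matrix.mul_assoc, eichW_matT_mul hC hψ C y (hgoodT _ M hM) (hTMC _)]

/-! ### The pairing lemma: `(1 - T)ℚ[M_n]` pairs to zero with `T`-invariant functions -/

omit [AddCommGroup A] in
/-- Orbit sums only see the orbit. [folklore] -/
theorem orbT_congr_on {ζ₁ ζ₂ : Mat → ℚ} {M : Mat} (h : ∀ k : ℤ, ζ₁ (matT k * M) = ζ₂ (matT k * M)) :
    orbT ζ₁ M = orbT ζ₂ M := by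
  unfold orbT
  exact finsum_congr h

omit [AddCommGroup A] in
/-- Orbit bookkeeping: membership in a `Γ_∞`-orbit is symmetric/transitive. [folklore] -/
theorem exists_matT_mul_of_matT_mul_eq {M M₀ : Mat} {j : ℤ} (h : matT j * M = M₀) (k : ℤ) :
    ∃ i : ℤ, matT k * M = matT i * M₀ := by
  refine ⟨k - j, ?_⟩
  rw [← h, ← Matrix.mul_assoc, matT_mul_matT]
  ring_nf

variable [Module ℚ A]

/-- **Pairing lemma.** If `η : M₂(ℤ) → ℚ` is finitely supported on matrices of determinant
`n ≠ 0` and all its `Γ_∞`-orbit sums vanish (i.e. `η ∈ (1 - T)ℚ[M_n]`), then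
`∑_M η(M) W(M) = 0` for every `W` that is `T`-invariant on matrices of determinant `n`.
[cite: PopaZagier2017, §2 (proof of Thm. 1)] -/
theorem finsum_smul_eq_zero_of_orbT {n : ℤ} (hn : n ≠ 0) (W : Mat → A)
    (hW : ∀ M : Mat, M.det = n → ∀ k : ℤ, W (matT k * M) = W M) :
    ∀ (s : Finset Mat) (η : Mat → ℚ), Function.support η ⊆ s → (∀ M, η M ≠ 0 → M.det = n) →
      (∀ M : Mat, M.det = n → orbT η M = 0) → ∑ᶠ M, η M • W M = 0 := by
  classical
  intro s
  induction s using Finset.strongInduction with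
  | H s ih =>
    intro η hsupp hdet horb
    by_cases h0 : ∀ M, η M = 0
    · simp [h0]
    push Not at h0
    obtain ⟨M₀, hM₀⟩ := h0
    have hM₀s : M₀ ∈ s := hsupp (Function.mem_support.mpr hM₀)
    have hdet₀ : M₀.det = n := hdet M₀ hM₀
    have hrow₀ : M₀ 1 0 ≠ 0 ∨ M₀ 1 1 ≠ 0 := row_ne_zero_of_det_ne_zero (by rw [hdet₀]; exact hn)
    have hfin : (Function.support η).Finite := s.finite_toSet.subset hsupp
    -- the part of `η` on the orbit of `M₀`
    let ηO : Mat → ℚ := fun M => if ∃ k : ℤ, M = matT k * M₀ then η M else 0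
    let η' : Mat → ℚ := fun M => η M - ηO M
    have hηO_fin : (Function.support ηO).Finite := by
      refine hfin.subset fun M hM => ?_
      simp only [Function.mem_support, ne_eq, ηO] at hM ⊢
      by_contra h
      exact hM (by simp [h])
    have hη'_fin : (Function.support η').Finite := by
      refine hfin.subset fun M hM => ?_
      simp only [Function.mem_support, ne_eq, η', ηO] at hM ⊢
      by_contra h
      exact hM (by simp [h])
    -- split the sum
    have hsplit : ∑ᶠ M, η M • W M = ∑ᶠ M, η' M • W M + ∑ᶠ M, ηO M • W M := by
      rw [← finsum_add_distrib (f := fun M => η' M • W M) (g := fun M => ηO M • W M)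
        (hη'_fin.subset (Function.support_smul_subset_left η' W))
        (hηO_fin.subset (Function.support_smul_subset_left ηO W))]
      congr 1
      funext M
      simp only [η', sub_smul, sub_add_cancel]
    -- the orbit part vanishes: `∑ ηO • W = (orbT η M₀) • W M₀ = 0`
    have hO : ∑ᶠ M, ηO M • W M = 0 := by
      have h1 : ∑ᶠ M, ηO M • W M = ∑ᶠ k : ℤ, ηO (matT k * M₀) • W (matT k * M₀) := by
        have hinj : Function.Injective fun k : ℤ => matT k * M₀ := matT_mul_injective hrow₀
        rw [← finsum_mem_univ (fun M => ηO M • W M),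
          ← finsum_mem_inter_support_eq' (fun M => ηO M • W M) (Set.range fun k : ℤ => matT k * M₀)
            Set.univ ?_, finsum_mem_range hinj]
        intro M hM
        simp only [Set.mem_univ, iff_true, Set.mem_range]
        have hM' : ηO M ≠ 0 := fun h => by simp [h] at hM
        simp only [ne_eq, ηO] at hM'
        by_cases hex : ∃ k : ℤ, M = matT k * M₀
        · obtain ⟨k, rfl⟩ := hex
          exact ⟨k, rfl⟩
        · exact absurd (by simp [hex]) hM'
      rw [h1]
      have h2 : ∀ k : ℤ, ηO (matT k * M₀) • W (matT k * M₀) = η (matT k * M₀) • W M₀ := by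
        intro k
        have hex : ∃ i : ℤ, matT k * M₀ = matT i * M₀ := ⟨k, rfl⟩
        simp only [ηO, if_pos hex, hW M₀ hdet₀ k]
      simp_rw [h2]
      rw [← finsum_smul' (finite_support_orbit hfin hrow₀)]
      change orbT η M₀ • W M₀ = 0
      rw [horb M₀ hdet₀, zero_smul]
    rw [hsplit, hO, add_zero]
    -- induction hypothesis for `η'` on `s.erase M₀`
    refine ih (s.erase M₀) (Finset.erase_ssubset hM₀s) η' ?_ ?_ ?_
    · -- support of `η'` avoids `M₀`
      intro M hM
      rw [Function.mem_support] at hM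
      rw [Finset.coe_erase, Set.mem_sdiff, Finset.mem_coe, Set.mem_singleton_iff]
      refine ⟨hsupp (Function.mem_support.mpr fun h => hM ?_), fun hMM₀ => hM ?_⟩
      · show η M - ηO M = 0
        simp only [ηO, h, ite_self, sub_zero]
      · show η M - ηO M = 0
        have hex : ∃ k : ℤ, M = matT k * M₀ := ⟨0, by rw [hMM₀, matT_zero, Matrix.one_mul]⟩
        simp only [ηO, if_pos hex, sub_self]
    · intro M hM
      refine hdet M fun h => hM ?_
      show η M - ηO M = 0
      simp only [ηO, h, ite_self, sub_zero]
    · intro M hM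
      have hrow : M 1 0 ≠ 0 ∨ M 1 1 ≠ 0 := row_ne_zero_of_det_ne_zero (by rw [hM]; exact hn)
      have hsub : orbT η' M = orbT η M - orbT ηO M := orbT_sub hfin hηO_fin hrow
      rw [hsub, horb M hM]
      -- `orbT ηO M` is `orbT η M = 0` on the orbit of `M₀` and `0` off it
      by_cases hex : ∃ j : ℤ, matT j * M = M₀
      · obtain ⟨j, hj⟩ := hex
        have : orbT ηO M = orbT η M := by
          refine orbT_congr_on ?_
          intro k
          simp only [ηO, if_pos (exists_matT_mul_of_matT_mul_eq hj k)]
        rw [this, horb M hM, sub_zero]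
      · have : orbT ηO M = orbT (fun _ => (0 : ℚ)) M := by
          refine orbT_congr_on ?_
          intro k
          simp only [ηO]
          rw [if_neg]
          rintro ⟨i, hi⟩
          apply hex
          refine ⟨k - i, ?_⟩
          have h2 : matT (-i) * (matT k * M) = matT (-i) * (matT i * M₀) := by rw [hi]
          rw [← Matrix.mul_assoc, ← Matrix.mul_assoc, matT_mul_matT, matT_mul_matT,
            show -i + i = 0 by ring, matT_zero, Matrix.one_mul,
            show -i + k = k - i by ring] at h2
          exact h2
        rw [this]
        simp [orbT]

/-! ### The Hermite representatives `R_n` and the orbit sums of `𝟙_{±R_n}`, `𝟙_{±R_n S⁻¹}` -/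

/-- `R_n = {(a b; 0 d) : a, d > 0, ad = n, 0 ≤ b < d}`, the Hermite normal forms of determinant
`n > 0` (representatives of `SL₂(ℤ) \ M_n` and of `Γ₀(N) \ Δ₀ᴺ(n)` for `(n, N) = 1`; the support
of `T_n^∞`). [cite: PopaZagier2017, §1 (`T_n^∞`)] -/
noncomputable def hermiteReps (n : ℤ) : Finset Mat :=
  ((Finset.Icc 1 n ×ˢ Finset.Ico 0 n).filter fun p => p.1 ∣ n ∧ p.2 < p.1).image
    fun p => !![n / p.1, p.2; 0, p.1]

/-- Membership in `R_n`. [folklore] -/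
theorem mem_hermiteReps {n : ℤ} (hn : 0 < n) (M : Mat) :
    M ∈ hermiteReps n ↔ M 1 0 = 0 ∧ 0 < M 0 0 ∧ 0 ≤ M 0 1 ∧ M 0 1 < M 1 1 ∧ M.det = n := by
  constructor
  · intro h
    simp only [hermiteReps, Finset.mem_image, Finset.mem_filter, Finset.mem_product,
      Finset.mem_Icc, Finset.mem_Ico] at h
    obtain ⟨⟨d, b⟩, ⟨⟨⟨hd1, hdn⟩, hb0, hbn⟩, hdvd, hbd⟩, rfl⟩ := h
    simp only at hdvd hbd ⊢
    have hq : n / d * d = n := Int.ediv_mul_cancel hdvd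
    have hqpos : 0 < n / d := by
      rcases lt_trichotomy (n / d) 0 with h | h | h
      · nlinarith
      · rw [h, zero_mul] at hq; omega
      · exact h
    refine ⟨by simp, by simpa using hqpos, by simpa using hb0, by simpa using hbd, ?_⟩
    rw [Matrix.det_fin_two_of]
    linarith
  · rintro ⟨hc, ha, hb0, hbd, hdet⟩
    have had : M 0 0 * M 1 1 = n := by rw [← hdet, Matrix.det_fin_two, hc]; ring
    have hd : 0 < M 1 1 := by omega
    simp only [hermiteReps, Finset.mem_image, Finset.mem_filter, Finset.mem_product,
      Finset.mem_Icc, Finset.mem_Ico]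
    refine ⟨⟨M 1 1, M 0 1⟩, ⟨⟨⟨by omega, ?_⟩, hb0, ?_⟩, ⟨M 0 0, by rw [← had, mul_comm]⟩, hbd⟩, ?_⟩
    · nlinarith
    · nlinarith
    · have hq : n / M 1 1 = M 0 0 := by
        rw [← had, Int.mul_ediv_cancel _ hd.ne']
      rw [hq]
      ext i j
      fin_cases i <;> fin_cases j
      · rfl
      · rfl
      · simp [hc]
      · rfl

/-- Elements of `R_n` have determinant `n`. [folklore] -/
theorem det_of_mem_hermiteReps {n : ℤ} (hn : 0 < n) {M : Mat} (h : M ∈ hermiteReps n) :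
    M.det = n := ((mem_hermiteReps hn M).mp h).2.2.2.2

/-- `M e₀ = a e₀` for `M ∈ R_n`. [folklore] -/
theorem mulVec_e0_of_mem_hermiteReps {n : ℤ} (hn : 0 < n) {M : Mat} (h : M ∈ hermiteReps n) :
    M *ᵥ e0 = M 0 0 • e0 := by
  obtain ⟨hc, -, -, -, -⟩ := (mem_hermiteReps hn M).mp h
  ext i; fin_cases i <;> simp [mulVec_two, hc, e0]

/-- The indicator of `±R_n` (an even function on matrices). [folklore] -/
noncomputable def rhoR (n : ℤ) (M : Mat) : ℚ :=
  if M ∈ hermiteReps n ∨ -M ∈ hermiteReps n then 1 else 0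

/-- Euclid: for `d > 0`, `0 ≤ b + kd < d` iff `k = -(b / d)`. [folklore] -/
theorem shift_mem_Ico_iff {b d : ℤ} (hd : 0 < d) (k : ℤ) : (0 ≤ b + k * d ∧ b + k * d < d) ↔ k = -(b / d) := by
  constructor
  · rintro ⟨h0, h1⟩
    have := (Int.ediv_emod_unique hd).mpr ⟨show b + k * d + d * (-k) = b by ring, h0, h1⟩
    omega
  · rintro rfl
    have e : b + -(b / d) * d = b % d := by rw [Int.emod_def]; ring
    rw [e]
    exact ⟨Int.emod_nonneg _ hd.ne', Int.emod_lt_of_pos _ hd⟩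

/-- **`orbT 𝟙_{±R_n} = 𝟙[c = 0]`** on matrices of determinant `n > 0`: every `Γ_∞`-orbit
`{T^k M}` with `M₁₀ = 0` contains exactly one element of `±R_n`, the others none.
[cite: PopaZagier2017, §2 (proof of Thm. 1: `M_n^∞` represents `Γ_∞ \ {c = 0}`)] -/
theorem orbT_rhoR {n : ℤ} (hn : 0 < n) {M : Mat} (hM : M.det = n) :
    orbT (rhoR n) M = if M 1 0 = 0 then 1 else 0 := by
  unfold orbT
  by_cases hc : M 1 0 = 0
  · rw [if_pos hc]
    have had : M 0 0 * M 1 1 = n := by rw [← hM, Matrix.det_fin_two, hc]; ring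
    have hentries : ∀ k : ℤ, (matT k * M) 1 0 = 0 ∧ (matT k * M) 0 0 = M 0 0 ∧
        (matT k * M) 0 1 = M 0 1 + k * M 1 1 ∧ (matT k * M) 1 1 = M 1 1 := by
      intro k
      obtain ⟨h00, h01, h10, h11⟩ := matT_mul_apply k M
      exact ⟨by rw [h10, hc], by rw [h00, hc]; ring, h01, h11⟩
    rcases lt_or_gt_of_ne (show M 1 1 ≠ 0 by rintro h; rw [h, mul_zero] at had; omega) with hd | hd
    · -- `a, d < 0`: only `-T^k M ∈ R_n`, for `k = -((-b) / (-d))`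
      have ha : M 0 0 < 0 := by nlinarith
      have hval : ∀ k : ℤ, rhoR n (matT k * M) = if k = -((-M 0 1) / (-M 1 1)) then 1 else 0 := by
        intro k
        obtain ⟨e10, e00, e01, e11⟩ := hentries k
        unfold rhoR
        have h1 : matT k * M ∉ hermiteReps n := by
          rw [mem_hermiteReps hn]; rintro ⟨-, h, -⟩; rw [e00] at h; omega
        have h2 : -(matT k * M) ∈ hermiteReps n ↔ k = -((-M 0 1) / (-M 1 1)) := by
          rw [mem_hermiteReps hn, ← shift_mem_Ico_iff (by omega : 0 < -M 1 1) k]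
          have hdet' : (-(matT k * M)).det = n := by simp [Matrix.det_neg, Matrix.det_mul, hM]
          simp only [Matrix.neg_apply, e10, e00, e01, e11, hdet', neg_zero, Left.neg_pos_iff, ha,
            true_and, and_true]
          constructor <;> rintro ⟨h0, h1⟩ <;> constructor <;> linarith
        by_cases hk : k = -((-M 0 1) / (-M 1 1))
        · rw [if_pos (Or.inr (h2.mpr hk)), if_pos hk]
        · rw [if_neg, if_neg hk]; push Not; exact ⟨h1, fun h => hk (h2.mp h)⟩
      simp_rw [hval]
      exact finsum_eq_single _ _ (fun k hk => if_neg hk) |>.trans (if_pos rfl)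
    · -- `a, d > 0`: only `T^k M ∈ R_n`, for `k = -(b / d)`
      have ha : 0 < M 0 0 := by nlinarith
      have hval : ∀ k : ℤ, rhoR n (matT k * M) = if k = -(M 0 1 / M 1 1) then 1 else 0 := by
        intro k
        obtain ⟨e10, e00, e01, e11⟩ := hentries k
        unfold rhoR
        have h1 : -(matT k * M) ∉ hermiteReps n := by
          rw [mem_hermiteReps hn]; rintro ⟨-, h, -⟩; rw [Matrix.neg_apply, e00] at h; omega
        have h2 : matT k * M ∈ hermiteReps n ↔ k = -(M 0 1 / M 1 1) := by
          rw [mem_hermiteReps hn, ← shift_mem_Ico_iff hd k]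
          have hdet' : (matT k * M).det = n := by simp [Matrix.det_mul, hM]
          simp only [e10, e00, e01, e11, hdet', ha, true_and, and_true]
        by_cases hk : k = -(M 0 1 / M 1 1)
        · rw [if_pos (Or.inl (h2.mpr hk)), if_pos hk]
        · rw [if_neg, if_neg hk]; push Not; exact ⟨fun h => hk (h2.mp h), h1⟩
      simp_rw [hval]
      exact finsum_eq_single _ _ (fun k hk => if_neg hk) |>.trans (if_pos rfl)
  · rw [if_neg hc]
    have hval : ∀ k : ℤ, rhoR n (matT k * M) = 0 := by
      intro k
      obtain ⟨-, -, h10, -⟩ := matT_mul_apply k M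
      unfold rhoR
      rw [if_neg]
      push Not
      constructor
      · rw [mem_hermiteReps hn]; rintro ⟨h, -⟩; rw [h10] at h; exact hc h
      · rw [mem_hermiteReps hn]; rintro ⟨h, -⟩; rw [Matrix.neg_apply, h10] at h; exact hc (neg_eq_zero.mp h)
    simp_rw [hval]
    exact finsum_zero

/-- **`orbT 𝟙_{±R_n S⁻¹} = 𝟙[d = 0]`** on matrices of determinant `n > 0`.
[cite: PopaZagier2017, §2 (proof of Thm. 1)] -/
theorem orbT_rhoR_mul_matS {n : ℤ} (hn : 0 < n) {M : Mat} (hM : M.det = n) :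
    orbT (fun B => rhoR n (B * matS)) M = if M 1 1 = 0 then 1 else 0 := by
  rw [orbT_mul_right, orbT_rhoR hn (by simp [Matrix.det_mul, hM])]
  simp [mul_apply_two]

/-- `𝟙_{±R_n}` has finite support. [folklore] -/
theorem finite_support_rhoR (n : ℤ) : (Function.support (rhoR n)).Finite := by
  classical
  refine ((hermiteReps n).finite_toSet.union ((hermiteReps n).image Neg.neg).finite_toSet).subset ?_
  intro M hM
  simp only [Function.mem_support, ne_eq, rhoR, ite_eq_right_iff, Classical.not_imp,
    one_ne_zero, not_false_eq_true, and_true] at hM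
  rcases hM with h | h
  · exact Or.inl h
  · right
    simp only [Finset.coe_image, Set.mem_image, Finset.mem_coe]
    exact ⟨-M, h, neg_neg M⟩

/-- `𝟙_{±R_n}` is supported on determinant `n`. [folklore] -/
theorem det_of_rhoR_ne_zero {n : ℤ} (hn : 0 < n) {M : Mat} (h : rhoR n M ≠ 0) : M.det = n := by
  unfold rhoR at h
  by_cases hM : M ∈ hermiteReps n ∨ -M ∈ hermiteReps n
  · rcases hM with hM | hM
    · exact det_of_mem_hermiteReps hn hM
    · have := det_of_mem_hermiteReps hn hM
      rw [Matrix.det_neg] at this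
      simpa using this
  · exact absurd (if_neg hM) h

/-! ### The two pairings and the main theorem -/

/-- Left multiplication by `S` as a permutation of `M₂(ℤ)`. [folklore] -/
def mulLeftS : Mat ≃ Mat where
  toFun M := matS * M
  invFun M := -(matS * M)
  left_inv M := by
    simp only [← Matrix.mul_assoc, matS_mul_matS]; simp
  right_inv M := by
    simp only [Matrix.mul_neg, ← Matrix.mul_assoc, matS_mul_matS]; simp

/-- The support of `ζ₀ = (1 - S)ξ` is finite. [folklore] -/
theorem finite_support_zeta0' {ξ : Mat → ℚ} (hfin : (Function.support ξ).Finite) :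
    (Function.support (zeta0 ξ)).Finite := by
  refine (hfin.union (finite_support_comp hfin (mul_left_injective_of_isUnit (g := matS) (by simp)))).subset ?_
  intro M hM
  simp only [Function.mem_support, zeta0, ne_eq] at hM
  by_contra h
  simp only [Set.mem_union, Function.mem_support, ne_eq, not_or, not_not] at h
  exact hM (by rw [h.1, h.2, sub_zero])

/-- **Left pairing**: `∑_M ζ₀(M) (E‖M)(C)_y = ∑_M ξ(M) [y adj M]` (`ζ₀ = ξ - ξ(S·)`),
from `E - E‖S = [·]` and `E‖(-1) = E`. [cite: PopaZagier2017, §2 (proof of Thm. 1)] -/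
theorem finsum_zeta0_smul_eichW (hC : CosetAction good act) (hψ : SymbolFamily act ψ)
    {ξ : Mat → ℚ} (hfin : (Function.support ξ).Finite)
    (hgood : ∀ M, ξ M ≠ 0 → good M) (hdet0 : ∀ M, ξ M ≠ 0 → M.det ≠ 0) (C : Mat)
    (hC0 : C *ᵥ e0 ≠ 0) (y : X) :
    ∑ᶠ M, zeta0 ξ M • eichW act ψ C y M = ∑ᶠ M, ξ M • msym ψ (act y (adjugate M)) := by
  have hfinS : (Function.support fun M => ξ (matS * M)).Finite :=
    finite_support_comp hfin (mul_left_injective_of_isUnit (g := matS) (by simp))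
  have h1 : ∑ᶠ M, zeta0 ξ M • eichW act ψ C y M =
      ∑ᶠ M, ξ M • eichW act ψ C y M - ∑ᶠ M, ξ (matS * M) • eichW act ψ C y M := by
    rw [← finsum_sub_distrib (f := fun M => ξ M • eichW act ψ C y M)
      (g := fun M => ξ (matS * M) • eichW act ψ C y M)
      (hfin.subset (Function.support_smul_subset_left _ _))
      (hfinS.subset (Function.support_smul_subset_left _ _))]
    refine finsum_congr fun M => ?_
    simp only [zeta0, sub_smul]
  -- reindex the second sum by `M ↦ S M`
  have h2 : ∑ᶠ M, ξ (matS * M) • eichW act ψ C y M = ∑ᶠ M, ξ M • eichW act ψ C y (matS * M) := by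
    rw [← finsum_comp_equiv mulLeftS (f := fun M => ξ M • eichW act ψ C y (matS * M))]
    refine finsum_congr fun M => ?_
    simp only [mulLeftS, Equiv.coe_fn_mk]
    rw [← Matrix.mul_assoc, matS_mul_matS, neg_mul, one_mul]
    by_cases hM : ξ (matS * M) = 0
    · rw [hM, zero_smul, zero_smul]
    · have hgM : good M := by
        have h := hC.neg (hC.mul (hC.of_det det_matS) (hgood _ hM))
        rw [← Matrix.mul_assoc, matS_mul_matS, neg_mul, one_mul, neg_neg] at h
        exact h
      rw [eichW_neg hC hψ C y hgM]
  have h3 : ∑ᶠ M, ξ M • eichW act ψ C y M - ∑ᶠ M, ξ M • eichW act ψ C y (matS * M) =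
      ∑ᶠ M, ξ M • (eichW act ψ C y M - eichW act ψ C y (matS * M)) := by
    rw [← finsum_sub_distrib (f := fun M => ξ M • eichW act ψ C y M)
      (g := fun M => ξ M • eichW act ψ C y (matS * M))
      (hfin.subset (Function.support_smul_subset_left _ _))
      (hfin.subset (Function.support_smul_subset_left _ _))]
    refine finsum_congr fun M => ?_
    simp only [smul_sub]
  rw [h1, h2, h3]
  refine finsum_congr fun M => ?_
  by_cases hM : ξ M = 0
  · simp [hM]
  · congr 1
    have hgM := hgood M hM
    -- `W(M) - W(SM) = [y adj M]`
    unfold eichW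
    rw [Matrix.adjugate_mul_distrib, ← hC.act_mul y (hC.adj hgM) (hC.adj (hC.of_det det_matS)),
      Matrix.mul_assoc]
    exact eich_sub_eichW_matS hψ (M * C) (by
      rw [← Matrix.mulVec_mulVec]
      exact mulVec_ne_zero_of_det_ne_zero (hdet0 M hM) hC0) (act y (adjugate M))

/-- **Right pairing**: `∑_M (𝟙_{±R_n} - 𝟙_{±R_n S⁻¹})(M) (E‖M)(1)_y
= 2 ∑_{C ∈ R_n} (ψ_{y S⁻¹ adj C}(C e₁) - ψ_{y S⁻¹ adj C}(e₀))` (the `R_n`-terms vanish since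
`C ∞ = ∞`). [cite: PopaZagier2017, §2 (proof of Thm. 1)] -/
theorem finsum_rhoR_smul_eichW (hC : CosetAction good act) (hψ : SymbolFamily act ψ) {n : ℤ}
    (hn : 0 < n) (hgood : ∀ M : Mat, M.det = n → good M) (y : X) :
    ∑ᶠ M, (rhoR n M - rhoR n (M * matS)) • eichW act ψ 1 y M =
      (2 : ℚ) • ∑ C ∈ hermiteReps n,
        (ψ (act (act y (adjugate matS)) (adjugate C)) (C *ᵥ e1) -
          ψ (act (act y (adjugate matS)) (adjugate C)) e0) := by
  classical
  have hfinR := finite_support_rhoR n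
  have hfinRS : (Function.support fun M => rhoR n (M * matS)).Finite :=
    finite_support_comp hfinR (mul_right_injective_of_isUnit (g := matS) (by simp))
  have hsplit : ∑ᶠ M, (rhoR n M - rhoR n (M * matS)) • eichW act ψ 1 y M =
      ∑ᶠ M, rhoR n M • eichW act ψ 1 y M - ∑ᶠ M, rhoR n (M * matS) • eichW act ψ 1 y M := by
    rw [← finsum_sub_distrib (f := fun M => rhoR n M • eichW act ψ 1 y M)
      (g := fun M => rhoR n (M * matS) • eichW act ψ 1 y M)
      (hfinR.subset (Function.support_smul_subset_left _ _))
      (hfinRS.subset (Function.support_smul_subset_left _ _))]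
    exact finsum_congr fun M => by simp only [sub_smul]
  rw [hsplit]
  -- the `R_n`-part vanishes termwise
  have hzero : ∑ᶠ M, rhoR n M • eichW act ψ 1 y M = 0 := by
    refine (finsum_congr fun M => ?_).trans finsum_zero
    by_cases h : rhoR n M = 0
    · rw [h, zero_smul]
    · have hW : eichW act ψ 1 y M = 0 := by
        unfold rhoR at h
        have hM : M ∈ hermiteReps n ∨ -M ∈ hermiteReps n := by
          by_contra hM; exact h (if_neg hM)
        unfold eichW eich
        rw [Matrix.mul_one]
        rcases hM with hM | hM
        · rw [mulVec_e0_of_mem_hermiteReps hn hM,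
            hψ.smul _ _ _ ((mem_hermiteReps hn M).mp hM).2.1.ne', sub_self]
        · have e : M *ᵥ e0 = (-(-M) 0 0) • e0 := by
            have := mulVec_e0_of_mem_hermiteReps hn hM
            rw [Matrix.neg_mulVec] at this
            rw [neg_smul, ← this, neg_neg]
          rw [e, hψ.smul _ _ _ (neg_ne_zero.mpr ((mem_hermiteReps hn (-M)).mp hM).2.1.ne'), sub_self]
      rw [hW, smul_zero]
  rw [hzero, zero_sub]
  -- the `R_n S⁻¹`-part: support `= R_n S ⊔ (-R_n S)`
  set R := hermiteReps n with hR
  have hinj1 : Set.InjOn (fun C : Mat => C * matS) R := fun C _ C' _ h =>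
    mul_right_injective_of_isUnit (g := matS) (by simp) h
  have hinj2 : Set.InjOn (fun C : Mat => -(C * matS)) R := fun C _ C' _ h =>
    mul_right_injective_of_isUnit (g := matS) (by simp) (neg_injective h)
  have hdisj : Disjoint (R.image fun C => C * matS) (R.image fun C => -(C * matS)) := by
    rw [Finset.disjoint_left]
    intro M h1 h2
    simp only [Finset.mem_image] at h1 h2
    obtain ⟨C, hC1, rfl⟩ := h1
    obtain ⟨C', hC', hCC'⟩ := h2
    have hneg : -C' = C :=
      mul_right_injective_of_isUnit (g := matS) (by simp) (by simpa [Matrix.neg_mul] using hCC')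
    have ha := ((mem_hermiteReps hn C).mp hC1).2.1
    have ha' := ((mem_hermiteReps hn C').mp hC').2.1
    rw [← hneg, Matrix.neg_apply] at ha
    omega
  have hsupp : Function.support (fun M => rhoR n (M * matS) • eichW act ψ 1 y M) ⊆
      ↑((R.image fun C => C * matS) ∪ (R.image fun C => -(C * matS))) := by
    intro M hM
    have h : rhoR n (M * matS) ≠ 0 := fun h => by simp [h] at hM
    unfold rhoR at h
    have hM' : M * matS ∈ R ∨ -(M * matS) ∈ R := by by_contra h'; exact h (if_neg h')
    simp only [Finset.coe_union, Finset.coe_image, Set.mem_union, Set.mem_image, Finset.mem_coe]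
    have hMS : M * matS * matS = -M := by rw [Matrix.mul_assoc, matS_mul_matS]; simp
    rcases hM' with h' | h'
    · right; exact ⟨M * matS, h', by rw [hMS, neg_neg]⟩
    · left; exact ⟨-(M * matS), h', by rw [Matrix.neg_mul, hMS, neg_neg]⟩
  rw [finsum_eq_sum_of_support_subset _ hsupp, Finset.sum_union hdisj, Finset.sum_image hinj1,
    Finset.sum_image hinj2]
  have hval : ∀ C ∈ R, rhoR n (C * matS * matS) = 1 ∧ rhoR n (-(C * matS) * matS) = 1 := by
    intro C hCR
    have hMS : C * matS * matS = -C := by rw [Matrix.mul_assoc, matS_mul_matS]; simp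
    unfold rhoR
    rw [Matrix.neg_mul, hMS, neg_neg]
    exact ⟨if_pos (Or.inr hCR), if_pos (Or.inl hCR)⟩
  have hW : ∀ C ∈ R, eichW act ψ 1 y (C * matS) =
      -(ψ (act (act y (adjugate matS)) (adjugate C)) (C *ᵥ e1) -
        ψ (act (act y (adjugate matS)) (adjugate C)) e0) := by
    intro C hCR
    have hgC : good C := hgood C (det_of_mem_hermiteReps hn hCR)
    unfold eichW eich
    rw [Matrix.mul_one, Matrix.adjugate_mul_distrib,
      ← hC.act_mul y (hC.adj (hC.of_det det_matS)) (hC.adj hgC), ← Matrix.mulVec_mulVec,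
      matS_mulVec_e0, neg_sub]
  rw [← Finset.sum_add_distrib, Finset.smul_sum, ← Finset.sum_neg_distrib]
  refine Finset.sum_congr rfl fun C hCR => ?_
  rw [(hval C hCR).1, (hval C hCR).2, one_smul, one_smul,
    eichW_neg hC hψ 1 y (hC.mul (hgood C (det_of_mem_hermiteReps hn hCR)) (hC.of_det det_matS)),
    hW C hCR, two_smul]
  abel

/-- **Property (A) implies Hecke-equivariance of M-symbols** ([PopaZagier2017, Thm. 1] in weight
`2` for the induced module, abstract form). For `ξ` even, finitely supported on `good` matrices of
determinant `n > 0` satisfying (A) in orbit-sum form (evenness is not needed: `-1` acts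
trivially), and any symbol family `ψ`:
`∑_M ξ(M) [y adj M] = 2 ∑_{C ∈ R_n} (ψ_{y S⁻¹ adj C}(C e₁) - ψ_{y S⁻¹ adj C}(e₀))`.
[cite: PopaZagier2017, §2 Thm. 1, §5] -/
theorem finsum_smul_msym_eq (hC : CosetAction good act) (hψ : SymbolFamily act ψ) {n : ℤ}
    (hn : 0 < n) {ξ : Mat → ℚ} (hfin : (Function.support ξ).Finite)
    (hdet : ∀ M, ξ M ≠ 0 → M.det = n) (hgood : ∀ M : Mat, M.det = n → good M)
    (hA : ∀ M : Mat, M.det = n →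
      orbT (zeta0 ξ) M = (if M 1 0 = 0 then 1 else 0) - (if M 1 1 = 0 then 1 else 0))
    (y : X) :
    ∑ᶠ M, ξ M • msym ψ (act y (adjugate M)) =
      (2 : ℚ) • ∑ C ∈ hermiteReps n,
        (ψ (act (act y (adjugate matS)) (adjugate C)) (C *ᵥ e1) -
          ψ (act (act y (adjugate matS)) (adjugate C)) e0) := by
  classical
  set W : Mat → A := eichW act ψ 1 y with hWdef
  -- `W` is `T`-invariant on determinant `n`
  have hW : ∀ M : Mat, M.det = n → ∀ k : ℤ, W (matT k * M) = W M := fun M hM k =>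
    eichW_matT_zpow_mul hC hψ 1 y (fun k M hM => hC.mul (hC.of_det (det_matT k)) hM) (hgood M hM)
      (by rw [Matrix.mul_one]; exact mulVec_ne_zero_of_det_ne_zero (by rw [hM]; exact hn.ne') e0_ne_zero)
      k
  -- the difference `η = ζ₀ - (𝟙_{±R} - 𝟙_{±R S⁻¹})` has vanishing orbit sums
  set η : Mat → ℚ := fun M => zeta0 ξ M - (rhoR n M - rhoR n (M * matS)) with hηdef
  have hfz := finite_support_zeta0' hfin
  have hfinR := finite_support_rhoR n
  have hfinRS : (Function.support fun M => rhoR n (M * matS)).Finite :=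
    finite_support_comp hfinR (mul_right_injective_of_isUnit (g := matS) (by simp))
  have hfρ : (Function.support fun M => rhoR n M - rhoR n (M * matS)).Finite := by
    refine (hfinR.union hfinRS).subset fun M hM => ?_
    by_contra h
    simp only [Set.mem_union, Function.mem_support, ne_eq, not_or, not_not] at h
    exact hM (by simp only [h.1, h.2, sub_self])
  have hfη : (Function.support η).Finite := by
    refine (hfz.union hfρ).subset fun M hM => ?_
    by_contra h
    simp only [Set.mem_union, Function.mem_support, ne_eq, not_or, not_not] at h
    exact hM (by simp only [hηdef, h.1, h.2, sub_self])
  have hdetη : ∀ M, η M ≠ 0 → M.det = n := by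
    intro M hM
    by_contra hd
    apply hM
    have h1 : zeta0 ξ M = 0 := by
      unfold zeta0
      have ha : ξ M = 0 := by by_contra h; exact hd (hdet M h)
      have hb : ξ (matS * M) = 0 := by
        by_contra h; exact hd (by have := hdet _ h; simpa [Matrix.det_mul] using this)
      rw [ha, hb, sub_zero]
    have h2 : rhoR n M = 0 := by by_contra h; exact hd (det_of_rhoR_ne_zero hn h)
    have h3 : rhoR n (M * matS) = 0 := by
      by_contra h; exact hd (by have := det_of_rhoR_ne_zero hn h; simpa [Matrix.det_mul] using this)
    simp only [hηdef, h1, h2, h3, sub_self]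
  have horb : ∀ M : Mat, M.det = n → orbT η M = 0 := by
    intro M hM
    have hrow : M 1 0 ≠ 0 ∨ M 1 1 ≠ 0 := row_ne_zero_of_det_ne_zero (by rw [hM]; exact hn.ne')
    rw [hηdef, orbT_sub hfz hfρ hrow, orbT_sub hfinR hfinRS hrow, hA M hM, orbT_rhoR hn hM,
      orbT_rhoR_mul_matS hn hM, sub_self]
  have hpair := finsum_smul_eq_zero_of_orbT hn.ne' W hW hfη.toFinset η (by simp) hdetη horb
  -- conclude
  rw [← finsum_zeta0_smul_eichW hC hψ hfin (fun M hM => hgood M (hdet M hM))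
      (fun M hM => by rw [hdet M hM]; exact hn.ne') 1 (by rw [Matrix.one_mulVec]; exact e0_ne_zero) y,
    ← finsum_rhoR_smul_eichW hC hψ hn hgood y, ← sub_eq_zero,
    ← finsum_sub_distrib (f := fun M => zeta0 ξ M • eichW act ψ 1 y M)
      (g := fun M => (rhoR n M - rhoR n (M * matS)) • eichW act ψ 1 y M)
      (hfz.subset (Function.support_smul_subset_left _ _))
      (hfρ.subset (Function.support_smul_subset_left _ _)), ← hpair]
  refine finsum_congr fun M => ?_
  simp only [hηdef, hWdef, sub_smul]

end Abstract

end Literature.NumberTheory.Automorphic.PopaZagier
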